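import Literature.NumberTheory.ConnesConsani2021.QuasiInnerLocalFactors
import HarnessLib

/-!
# Connes–Consani 2021 (JNT) §2 — Theorems 2.1 and 2.3 from display «aminusk» (PROVED reductions)

LINE 1 — LABEL: RH-FREE corpus literature (operator-theoretic bookkeeping of the printed proofs of
Thm 2.1/Thm 2.3 of *Quasi-inner functions and local factors*; no positivity statement, no statement about
zeros of `ζ`); bears_on: W-C/W-P (sequel typing, no leaf role); WHAT THIS IS NOT: any claim about RH —
nothing in this file bears on the truth of RH.

Source: A. Connes, C. Consani, *Quasi-inner functions and local factors*, J. Number Theory **226** (2021)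
139–167 = arXiv:2008.10974 [bib: `ConnesConsani2021QuasiInner`]; locators are arXiv tex chunks
`pNNNN:Lnn`.  Companion of `QuasiInnerLocalFactors.lean` (cell rh-crit/cc, seat t17; that file reached the
gate's 200 kB size cap, so this last §2 reduction is filed separately, same namespace).

Content (RH-FREE).  The printed proof of Theorem 2.3 — «The negative part of the Fourier expansion of `κ`
is expressed (aminusk) as a linear combination of the `f_{x_n}` while the off diagonal part is computed by
Lemma 2.2» (p0006:L59) — as the reduction `thm_2_3_of_display_aminusk : display_aminusk → thm_2_3`: the
`(−k−1)`-st Fourier coefficient of the model symbol `Σ α(n)f_{x(n)}` (`kappaArchNegPart`, landed) is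
`Σ α(n)x(n)^k = a_{−k−1}` (`fourierCoeff_kappaArchNegPart`), so under display «aminusk» the symbols
`κ|S¹` and `Σ α(n)f_{x(n)}` have the same negative Fourier coefficients, hence (landed
`hardyOffDiag_eq_zero_of_fourierCoeff_neg_eq_zero`, linearity of `hardyOffDiagL`) the same off-diagonal
part, and Theorem 2.3 is its landed model-symbol version `hasSum_hardyOffDiag_kappaArchNegPart`.  With the
landed `thm_2_1_of_thm_2_3`: `thm_2_1_of_display_aminusk`.  Net effect on the named-fact DAG of §2:
`thm_2_1 ⇐ thm_2_3 ⇐ display_aminusk` (the residue computation of `a_{−k}`, p0005:L46–L115, is the single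
remaining root).

Nothing in this file bears on the truth of RH.
-/

noncomputable section

open _root_.MeasureTheory _root_.Complex AddCircle Filter Set
open scoped Real ENNReal InnerProductSpace Topology ComplexConjugate

namespace Literature.NumberTheory.ConnesConsani2021

namespace QuasiInner

section DisplayAminuskToThmTwoThree

open scoped Nat

/-! ### Display «aminusk» ⇒ Theorem 2.3 (hence ⇒ Theorem 2.1)

RH-FREE.  The negative Fourier coefficients of `κ|S¹` and of the model symbol `Σ α(n)f_{x(n)}` agree when
display «aminusk» holds (`f̂_x(−k) = x^{k−1}`, `fourierCoeff_xiVec`); hence their difference has vanishing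
negative coefficients and zero off-diagonal part (`hardyOffDiag_eq_zero_of_fourierCoeff_neg_eq_zero`), so
`(1 − 𝒫)κ𝒫 = (1 − 𝒫)(Σ α(n)f_{x(n)})𝒫 = Σ c_n|ξ_n⟩⟨η_n|` (`hasSum_hardyOffDiag_kappaArchNegPart`).  This is
the printed proof of Theorem 2.3 («The negative part of the Fourier expansion of `κ` is expressed (aminusk)
as a linear combination of the `f_{x_n}` while the off diagonal part is computed by Lemma 2.2», p0006:L59)
as a PROVED reduction `thm_2_3_of_display_aminusk : display_aminusk → thm_2_3`; with `thm_2_1_of_thm_2_3`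
the whole of §2's Theorems 2.1 and 2.3 rests on the single named fact `display_aminusk` (the residue
computation of the coefficients `a_{−k}`). -/

variable (T : ℝ) [hT : Fact (0 < T)] in
/-- RH-FREE. Fourier coefficients only depend on the a.e. class. [folklore] -/
private theorem l23_fourierCoeff_congr_ae {f g : AddCircle T → ℂ}
    (h : f =ᵐ[haarAddCircle (T := T)] g) (n : ℤ) :
    fourierCoeff (T := T) f n = fourierCoeff (T := T) g n := by
  simp only [fourierCoeff]
  exact integral_congr_ae (by filter_upwards [h] with x hx; simp only [hx])

variable (T : ℝ) [hT : Fact (0 < T)] in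
/-- RH-FREE. The embedding `L^∞(S¹) → L²(S¹)`, `u ↦ u · e_0`, as a continuous linear map (Hölder action on the
constant mode). [folklore] -/
private def linftyToL2 : Lp ℂ ∞ (haarAddCircle (T := T)) →L[ℂ] Lp ℂ 2 (haarAddCircle (T := T)) :=
  ((ContinuousLinearMap.mul ℂ ℂ).holderL (haarAddCircle (T := T)) ∞ 2 2).flip (fourierLp (T := T) 2 0)

variable (T : ℝ) [hT : Fact (0 < T)] in
/-- RH-FREE. The embedding `L^∞ → L²` does not change the a.e. class. [folklore] -/
private theorem l23_coeFn_linftyToL2 (u : Lp ℂ ∞ (haarAddCircle (T := T))) :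
    (linftyToL2 T u : AddCircle T → ℂ) =ᵐ[haarAddCircle (T := T)] (u : AddCircle T → ℂ) := by
  have h1 : linftyToL2 T u = mulOp haarAddCircle u (fourierLp (T := T) 2 0) := rfl
  rw [h1]
  filter_upwards [coeFn_mulOp haarAddCircle u (fourierLp (T := T) 2 0), coeFn_fourierLp (T := T) 2 0]
    with y h2 h3
  rw [h2, h3, fourier_zero, mul_one]

variable (T : ℝ) [hT : Fact (0 < T)] in
/-- RH-FREE. **The `m`-th Fourier coefficient as a continuous linear functional on `L^∞(S¹)`**
(`u ↦ ⟨e_m | u⟩`). [folklore] -/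
private def fourierCoeffLinfty (m : ℤ) : Lp ℂ ∞ (haarAddCircle (T := T)) →L[ℂ] ℂ :=
  (innerSL ℂ (fourierLp (T := T) 2 m)).comp (linftyToL2 T)

variable (T : ℝ) [hT : Fact (0 < T)] in
/-- RH-FREE. `fourierCoeffLinfty T m u` is the `m`-th Fourier coefficient of (the a.e. class of) `u`. [folklore] -/
private theorem l23_fourierCoeffLinfty_apply (m : ℤ) (u : Lp ℂ ∞ (haarAddCircle (T := T))) :
    fourierCoeffLinfty T m u = fourierCoeff (T := T) (u : AddCircle T → ℂ) m := by
  simp only [fourierCoeffLinfty, ContinuousLinearMap.comp_apply, innerSL_apply_apply]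
  rw [← l23_fourierCoeff_congr_ae T (l23_coeFn_linftyToL2 T u) m, ← fourierBasis_repr,
    ← coe_fourierBasis]
  exact (fourierBasis.repr_apply_apply (linftyToL2 T u) m).symm

/-- RH-FREE. `f_x` restricted to the circle is continuous for `|x| < 1`. [folklore] -/
private theorem r23_continuous_circleRestrict_szegoNeg (T : ℝ) [Fact (0 < T)] {x : ℂ} (hx : ‖x‖ < 1) :
    Continuous (circleRestrict T (szegoNeg x)) := by
  have hinv : Continuous fun y : AddCircle T => ((toCircle y : ℂ))⁻¹ :=
    Continuous.inv₀ (by fun_prop) fun y => Circle.coe_ne_zero _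
  have h : circleRestrict T (szegoNeg x) =
      fun y : AddCircle T => ((toCircle y : ℂ))⁻¹ * (1 - x * ((toCircle y : ℂ))⁻¹)⁻¹ := rfl
  rw [h]
  refine hinv.mul (Continuous.inv₀ (continuous_const.sub (continuous_const.mul hinv)) fun y h0 => ?_)
  have h1 : ‖x * ((toCircle y : ℂ))⁻¹‖ < 1 := by
    rw [norm_mul, norm_inv, Circle.norm_coe, inv_one, mul_one]; exact hx
  rw [sub_eq_zero] at h0
  rw [← h0, norm_one] at h1
  exact lt_irrefl _ h1

/-- RH-FREE. The a.e. class of `f_x` in `L^∞` and in `L²` is the same function `ξ_x`. [folklore] -/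
private theorem l23_coeFn_szegoNegLinfty_ae_eq_xiVec {x : ℂ} (hx : ‖x‖ < 1) :
    ((toLpOrZero ∞ haarAddCircle (circleRestrict 1 (szegoNeg x)) : Lp ℂ ∞ (haarAddCircle (T := 1))) :
        AddCircle (1:ℝ) → ℂ) =ᵐ[haarAddCircle (T := 1)]
      ((xiVec 1 x : Lp ℂ 2 (haarAddCircle (T := 1))) : AddCircle (1:ℝ) → ℂ) := by
  have hcont := r23_continuous_circleRestrict_szegoNeg 1 hx
  have hbound : ∀ y : AddCircle (1:ℝ), ‖circleRestrict 1 (szegoNeg x) y‖ ≤ (1 - ‖x‖)⁻¹ := by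
    intro y
    have hv : ‖((toCircle y : Circle) : ℂ)‖ = 1 := Circle.norm_coe _
    have h1 : 0 < 1 - ‖x‖ := by linarith
    show ‖((toCircle y : ℂ))⁻¹ * (1 - x * ((toCircle y : ℂ))⁻¹)⁻¹‖ ≤ (1 - ‖x‖)⁻¹
    rw [norm_mul, norm_inv, hv, inv_one, one_mul, norm_inv]
    refine inv_anti₀ h1 ?_
    calc 1 - ‖x‖ = ‖(1 : ℂ)‖ - ‖x * ((toCircle y : ℂ))⁻¹‖ := by
          rw [norm_one, norm_mul, norm_inv, hv, inv_one, mul_one]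
      _ ≤ ‖1 - x * ((toCircle y : ℂ))⁻¹‖ := norm_sub_norm_le _ _
  have hmemTop : MemLp (circleRestrict 1 (szegoNeg x)) ∞ (haarAddCircle (T := 1)) :=
    memLp_top_of_bound hcont.aestronglyMeasurable _ (ae_of_all _ hbound)
  have hmem2 : MemLp (circleRestrict 1 (szegoNeg x)) 2 (haarAddCircle (T := 1)) :=
    hmemTop.mono_exponent le_top
  rw [xiVec, toLpOrZero_eq_toLp hmemTop, toLpOrZero_eq_toLp hmem2]
  exact hmemTop.coeFn_toLp.trans hmem2.coeFn_toLp.symm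

/-- RH-FREE. `1 ≤ √π`. [folklore] -/
private theorem r23_one_le_sqrt_pi : 1 ≤ Real.sqrt π := by
  rw [show (1:ℝ) = Real.sqrt 1 by simp]
  exact Real.sqrt_le_sqrt (by linarith [Real.two_le_pi])

/-- RH-FREE. `Γ(n + ½) ≥ ½` for every `n ∈ ℕ`. [folklore] -/
private theorem r23_half_le_Gamma_nat_add_half (n : ℕ) : (1 / 2 : ℝ) ≤ Real.Gamma ((n : ℝ) + 1 / 2) := by
  rcases Nat.lt_or_ge n 2 with hn | hn
  · interval_cases n
    · simp only [CharP.cast_eq_zero, zero_add, Real.Gamma_one_half_eq]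
      linarith [r23_one_le_sqrt_pi]
    · rw [show ((1 : ℕ) : ℝ) + 1 / 2 = 1 / 2 + 1 by norm_num, Real.Gamma_add_one (by norm_num),
        Real.Gamma_one_half_eq]
      linarith [r23_one_le_sqrt_pi]
  · have h2 : (2 : ℝ) ≤ (n : ℝ) + 1 / 2 := by
      have : (2 : ℝ) ≤ n := by exact_mod_cast hn
      linarith
    have hmono := Real.Gamma_strictMonoOn_Ici.monotoneOn (Set.self_mem_Ici) (Set.mem_Ici.mpr h2) h2
    rw [Real.Gamma_two] at hmono
    linarith

/-- RH-FREE. `|α(n)| ≤ 32√π π^{2n}/n!` (so `Σ α(n) x(n)^k` converges absolutely for every `k`). [folklore] -/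
private theorem l23_abs_alphaArch_le (n : ℕ) : |alphaArch n| ≤ 32 * Real.sqrt π * (π ^ 2) ^ n / n ! := by
  have hG1 : Real.Gamma ((n : ℝ) + 1) = n ! := Real.Gamma_nat_eq_factorial n
  have hG2 := r23_half_le_Gamma_nat_add_half n
  have hG2pos : 0 < Real.Gamma ((n : ℝ) + 1 / 2) := by linarith
  have hfac : (0 : ℝ) < n ! := by positivity
  have h43 : (1 : ℝ) ≤ (4 * n + 3) ^ 2 := by
    have : (0 : ℝ) ≤ n := n.cast_nonneg
    nlinarith
  have habs : |alphaArch n| = 16 * (Real.sqrt π * (π ^ 2) ^ n) * ((4 * (n : ℝ) + 3) ^ 2)⁻¹ /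
      (n ! * Real.Gamma ((n : ℝ) + 1 / 2)) := by
    unfold alphaArch
    rw [hG1, abs_div, abs_mul, abs_mul, abs_mul, abs_pow, abs_neg, abs_one, one_pow, one_mul,
      abs_of_pos (by norm_num : (0:ℝ) < 16),
      abs_of_nonneg (by positivity : (0:ℝ) ≤ Real.sqrt π * π ^ (2 * n)),
      abs_of_pos (by positivity : (0:ℝ) < ((4 * (n : ℝ) + 3) ^ 2)⁻¹),
      abs_of_pos (by positivity : (0:ℝ) < n ! * Real.Gamma ((n : ℝ) + 1 / 2)), pow_mul]
  rw [habs]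
  have hinv : ((4 * (n : ℝ) + 3) ^ 2)⁻¹ ≤ 1 := inv_le_one_of_one_le₀ h43
  calc 16 * (Real.sqrt π * (π ^ 2) ^ n) * ((4 * (n : ℝ) + 3) ^ 2)⁻¹ / (n ! * Real.Gamma ((n : ℝ) + 1 / 2))
      ≤ 16 * (Real.sqrt π * (π ^ 2) ^ n) * 1 / (n ! * (1 / 2)) := by
        apply div_le_div₀ (by positivity) (mul_le_mul_of_nonneg_left hinv (by positivity)) (by positivity)
        exact mul_le_mul_of_nonneg_left hG2 hfac.le
    _ = 32 * Real.sqrt π * (π ^ 2) ^ n / n ! := by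
        field_simp
        ring

/-- RH-FREE. **The negative Fourier coefficients of the model symbol**: the `(−k−1)`-st coefficient of
`Σ α(n)f_{x(n)}` is `Σ α(n)x(n)^k = a_{−k−1}` (display «aminusk» evaluated termwise, `f̂_x(−k−1) = x^k`).
[cite: ConnesConsani2021QuasiInner, Thm 2.3, proof (arXiv chunk p0006:L59) with display «aminusk» (p0005:L115)] -/
theorem fourierCoeff_kappaArchNegPart (k : ℕ) :
    fourierCoeff (T := 1) ((kappaArchNegPart : Lp ℂ ∞ (haarAddCircle (T := 1))) : AddCircle (1:ℝ) → ℂ)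
      (-(k + 1 : ℤ)) = (archNegCoeff (k + 1) : ℂ) := by
  have h := (fourierCoeffLinfty 1 (-(k + 1 : ℤ))).hasSum hasSum_kappaArchNegPart
  simp only [map_smul, l23_fourierCoeffLinfty_apply, smul_eq_mul] at h
  have hterm : ∀ n : ℕ, fourierCoeff (T := 1)
      ((toLpOrZero ∞ haarAddCircle (circleRestrict 1 (szegoNeg (xArch n : ℂ))) :
        Lp ℂ ∞ (haarAddCircle (T := 1))) : AddCircle (1:ℝ) → ℂ) (-(k + 1 : ℤ)) = (xArch n : ℂ) ^ k := by
    intro n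
    have hx : ‖(xArch n : ℂ)‖ < 1 := by
      rw [Complex.norm_real, Real.norm_eq_abs]; exact xArch_lt_one n
    rw [l23_fourierCoeff_congr_ae 1 (l23_coeFn_szegoNegLinfty_ae_eq_xiVec hx), (fourierCoeff_xiVec 1 _ hx k).1]
  simp only [hterm] at h
  -- the real series
  have hs : Summable fun n : ℕ => alphaArch n * xArch n ^ k := by
    have hmaj : Summable fun n : ℕ => 32 * Real.sqrt π * (π ^ 2) ^ n / n ! := by
      have := (Real.summable_pow_div_factorial (π ^ 2)).mul_left (32 * Real.sqrt π)
      refine this.congr fun n => ?_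
      ring
    refine Summable.of_norm_bounded hmaj fun n => ?_
    rw [Real.norm_eq_abs, abs_mul, abs_pow]
    calc |alphaArch n| * |xArch n| ^ k ≤ |alphaArch n| * 1 :=
          mul_le_mul_of_nonneg_left (pow_le_one₀ (abs_nonneg _) (xArch_lt_one n).le) (abs_nonneg _)
      _ ≤ _ := by rw [mul_one]; exact l23_abs_alphaArch_le n
  have h2 : HasSum (fun n : ℕ => ((alphaArch n * xArch n ^ k : ℝ) : ℂ)) ((archNegCoeff (k + 1) : ℝ) : ℂ) := by
    have e : archNegCoeff (k + 1) = ∑' n : ℕ, alphaArch n * xArch n ^ k := by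
      simp [archNegCoeff]
    rw [e]
    exact (Complex.ofRealCLM.hasSum hs.hasSum)
  push_cast at h2
  exact h.unique h2

/-- RH-FREE. **Display «aminusk» ⇒ Theorem 2.3**: under the coefficient identity `κ̂(−k) = a_{−k}` (the typed
named fact `display_aminusk`) the symbols `κ|S¹` and `Σ α(n)f_{x(n)}` have the same negative Fourier
coefficients, hence the same off-diagonal part, and Theorem 2.3 follows from its model-symbol version.
PROVED reduction (the printed proof of Thm 2.3, p0006:L59–L68); combined with `thm_2_1_of_thm_2_3` it also
gives Theorem 2.1 from display «aminusk».
[cite: ConnesConsani2021QuasiInner, Thm 2.3 «thmkappa», proof (arXiv chunk p0006:L59–L68)] -/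
theorem thm_2_3_of_display_aminusk (h : display_aminusk) : thm_2_3 := by
  refine thm_2_3_of_hardyOffDiag_eq ?_
  obtain ⟨hmem, -, hu⟩ := memLp_circleRestrict_kappaArch
  have hcoef : ∀ k : ℕ, fourierCoeff (T := 1)
      ((toLpOrZero ∞ haarAddCircle (circleRestrict 1 kappaArch) - kappaArchNegPart :
        Lp ℂ ∞ (haarAddCircle (T := 1))) : AddCircle (1:ℝ) → ℂ) (-(k + 1 : ℤ)) = 0 := by
    intro k
    rw [← l23_fourierCoeffLinfty_apply, map_sub, l23_fourierCoeffLinfty_apply,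
      l23_fourierCoeffLinfty_apply, fourierCoeff_kappaArchNegPart, sub_eq_zero]
    have e : ((toLpOrZero ∞ haarAddCircle (circleRestrict 1 kappaArch) :
        Lp ℂ ∞ (haarAddCircle (T := 1))) : AddCircle (1:ℝ) → ℂ) =ᵐ[haarAddCircle (T := 1)]
        circleRestrict 1 kappaArch := by
      rw [hu]
      exact MemLp.coeFn_toLp _
    rw [l23_fourierCoeff_congr_ae 1 e]
    have h' := h (k + 1) (by omega)
    push_cast at h'
    exact h'
  have hzero := hardyOffDiag_eq_zero_of_fourierCoeff_neg_eq_zero 1 _ hcoef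
  rw [← hardyOffDiagL_apply, map_sub, hardyOffDiagL_apply, hardyOffDiagL_apply, sub_eq_zero] at hzero
  exact hzero

/-- RH-FREE. **Display «aminusk» ⇒ Theorem 2.1** (composition of the two PROVED reductions
`thm_2_3_of_display_aminusk` and `thm_2_1_of_thm_2_3`).
[cite: ConnesConsani2021QuasiInner, Thm 2.1 «thmquasiinner0» (p0005:L124–L136) with Thm 2.3 (p0006:L49–L68)] -/
theorem thm_2_1_of_display_aminusk (h : display_aminusk) : thm_2_1 :=
  thm_2_1_of_thm_2_3 (thm_2_3_of_display_aminusk h)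

end DisplayAminuskToThmTwoThree

end QuasiInner

end Literature.NumberTheory.ConnesConsani2021
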